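import Summits.QuantumAdvantage.QuantumAdvantage.Theorems.PromiseLiftPlLiftStubCertifyK8
import Summits.QuantumAdvantage.QuantumAdvantage.Theorems.WhiteBoxWalkWbwThesis
import Literature.Computability.QuantumComplexity.FBQPOracleAccess

/-!
Sketch (stub-ideation k2, FAMILY 2 — RESHAPE) for stub `stub_certified_thesis : WbwCertifiedThesis`
of line `certified-canonical-lift` (crux PlLift, stmt-QuantumAdvantage-0250).
Helper-lemma STATEMENTS only (sorried); elaboration sanity check.
-/

set_option linter.dupNamespace false

noncomputable section

namespace Summit.QuantumAdvantage.QuantumAdvantage.Cruxes.PlLift.CertifiedCanonicalLift.StubIdeasK2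

open Filter Asymptotics _root_.Computability Polynomial
open Literature.Computability.Complexity Literature.Computability.Cryptography
open Literature.Computability.QuantumComplexity
open Summit.QuantumAdvantage.QuantumAdvantage.Theorems (FactoringAssumption)
open Summit.QuantumAdvantage.QuantumAdvantage.Theorems.WhiteBoxWalk
  (genPQ ansPQ prePQ bigProd factorCode stub_extract stub_assemble isOneWay_genPQ stub_canon)

/-- zero-pad then truncate to length `ℓ` (forces `|·| = ℓ` on every input). -/
def takePad (ℓ : ℕ) (w : List Bool) : List Bool := (w ++ List.replicate ℓ false).take ℓ

theorem length_takePad (ℓ : ℕ) (w : List Bool) : (takePad ℓ w).length = ℓ := by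
  simp [takePad]

theorem takePad_of_length_eq {ℓ : ℕ} {w : List Bool} (h : w.length = ℓ) : takePad ℓ w = w := by
  simp [takePad, ← h]

/-! ### Plan A — regime split `V ≡ true` + weaken-to-`FactoringAssumption` -/

/-- A1 (S). Density regime: an everywhere-canonical planting is certified with the trivial verifier. -/
theorem certified_of_canonical : WbwCanonicalThesis → WbwCertifiedThesis := by
  rintro ⟨gen, ans, a, p, hgen, hag, hlen, ⟨F, hF, hU, hQ⟩, hC⟩
  exact ⟨gen, ans, a, fun _ => true, p, hgen, const_mem_FP [true], fun _ => rfl, hag, hlen,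
    ⟨F, hF, hU, fun x _ => hQ x⟩, hC⟩

/-- A2 (M). GENERIC everywhere-canonicity: an `FBQP` function with an `FP` canonicaliser (`pick ⟨u, y⟩ = f u`
whenever `f u <+: y`), planted through `FP` pre/post-processing, is written canonically on EVERY input. -/
theorem everywhereQ_of_mem_FBQP {f pre post pick : List Bool → List Bool} (p : Polynomial ℕ)
    (hf : f ∈ FBQP) (hpre : pre ∈ FP) (hpost : post ∈ FP) (hpick : pick ∈ FP)
    (hread : ∀ u y, f u <+: y → pick (boolPair u y) = f u) :
    ∃ F : QCircuitFamily cliffordT, F.IsOracleFree ∧ F.IsUniform ∧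
      ∀ x, 2 / 3 ≤ F.kernelProb 0 x
        {y | takePad (p.eval x.length) (post (boolPair x (f (pre x)))) <+: y} := by
  sorry

/-- A2' (S). The factor-list code has an `FP` canonicaliser (tree: `Knapsack.canonLFn`,
`canonLFn_eq`, `listBool_decode_encode_append`; cf. `factorGraph_mem_BQP`). -/
theorem factorCode_pick : ∃ pick : List Bool → List Bool, pick ∈ FP ∧
    ∀ (u y : List Bool), factorCode (decodeNat u) <+: y → pick (boolPair u y) = factorCode (decodeNat u) := by
  sorry

/-- A3 (S–M). Clause (C) from one-wayness + canonical preimage — the (C)-half of the landed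
`stub_bridge` (truncation adversary `Bridge.isPPT_of_run_eq_take`), stated on its own. -/
theorem clauseC_of_isOneWay {gen pre : List Bool → List Bool} (hgen : IsOneWay gen)
    (hpre : ∀ s, gen (pre s) = gen s) (hlen : ∀ s, (pre s).length = s.length)
    (hle : ∀ s, s.length ≤ (gen s).length) :
    ∀ A : RandAlg (List Bool) (List Bool), IsPPT A id →
      SuperpolynomialDecay atTop (fun n : ℕ => (n : ℝ)) fun n : ℕ =>
        uniformAvg n fun s => A.pr id (boolPair (unaryEncodeNat n) (gen s))
          {y | pre s ++ List.replicate ((gen s).length - s.length) false <+: y} := by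
  sorry

/-- A4 (M). The everywhere-canonical answer map of the factoring witness and its two identities:
`aPQ x := takePad |x| (post ⟨x, factorCode ⟦pre x⟧⟩)` with `pre, post` the FP programs of
`stub_extract` / `stub_assemble`; `aPQ (genPQ w) = ansPQ w`, `|aPQ x| = |x|`, quantum clause on EVERY `x`. -/
theorem canonical_factoring_witness :
    ∃ a : List Bool → List Bool, (∀ w, a (genPQ w) = ansPQ w) ∧ (∀ x, (a x).length = (X : Polynomial ℕ).eval x.length) ∧
      ∃ F : QCircuitFamily cliffordT, F.IsOracleFree ∧ F.IsUniform ∧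
        ∀ x, 2 / 3 ≤ F.kernelProb 0 x {y | a x <+: y} := by
  sorry

/-- Assembly of Plan A (S given A1–A4): the factoring assumption implies X_pd and X_cert. -/
theorem canonicalThesis_of_factoringAssumption (hF : FactoringAssumption) : WbwCanonicalThesis := by
  obtain ⟨a, hag, hlen, hQ⟩ := canonical_factoring_witness
  refine ⟨genPQ, ansPQ, a, X, (isOneWay_genPQ hF).1, hag, hlen, hQ, ?_⟩
  intro A hA
  simpa [ansPQ] using clauseC_of_isOneWay (isOneWay_genPQ hF) (fun w => (stub_canon w).1)
    (fun w => (stub_canon w).2.1) (fun w => (stub_canon w).2.2) A hA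

theorem certifiedThesis_of_factoringAssumption (hF : FactoringAssumption) : WbwCertifiedThesis :=
  certified_of_canonical (canonicalThesis_of_factoringAssumption hF)

/-! ### Plan B — engine-facing reshape lemmas (Shor-neutral; provable now) -/

/-- B1 (S–M). "Injectivity supplies canonicity": a solver that finds, on certified inputs, SOME
`f`-preimage (of the advertised length) of a public handle `h x`, `f` injective, is pseudo-deterministic. -/
theorem canonical_of_injective_handle {f h : List Bool → List Bool} (hf : Function.Injective f)
    (V : List Bool → Bool) (p : Polynomial ℕ) (F : QCircuitFamily cliffordT)
    (hQ : ∀ x, V x = true → 2 / 3 ≤ F.kernelProb 0 x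
      {y | ∃ v, v.length = p.eval x.length ∧ f v = h x ∧ v <+: y}) :
    ∃ a : List Bool → List Bool, (∀ x, (a x).length = p.eval x.length) ∧
      ∀ x, V x = true → 2 / 3 ≤ F.kernelProb 0 x {y | a x <+: y} := by
  classical
  -- the canonical answer: the unique advertised-length preimage of the handle, zeros if none
  let a : List Bool → List Bool := fun x =>
    if hx : ∃ v : List Bool, v.length = p.eval x.length ∧ f v = h x then hx.choose
    else List.replicate (p.eval x.length) false
  refine ⟨a, fun x => ?_, fun x hV => ?_⟩
  · simp only [a]
    split_ifs with hx
    · exact hx.choose_spec.1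
    · exact List.length_replicate ..
  · refine (hQ x hV).trans (F.kernelProb_mono 0 x ?_)
    rintro y ⟨v, hvl, hfv, hvy⟩
    have hx : ∃ v : List Bool, v.length = p.eval x.length ∧ f v = h x := ⟨v, hvl, hfv⟩
    have hav : a x = v := by
      simp only [a, dif_pos hx]
      exact hf (hx.choose_spec.2.trans hfv.symm)
    show a x <+: y
    rw [hav]; exact hvy

/-- B2 (L). Verifiable-search amplification `1/(q+1) → 2/3` on the certified set: the answer is
recognised by the FP test `f (y ↾ p|x|) = h x`, so independent repetition + first-accepted selection
amplifies (needs a juxtaposition/repetition brick for uniform families, cf. `JuxtaposedDeciders`,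
`mem_PromiseBQP_of_oneSided_trials`). -/
theorem amplify_handle_search {f h : List Bool → List Bool} (hfFP : f ∈ FP) (hhFP : h ∈ FP)
    (p q : Polynomial ℕ) (V : List Bool → Bool)
    (hQ : ∃ F : QCircuitFamily cliffordT, F.IsOracleFree ∧ F.IsUniform ∧ ∀ x, V x = true →
      (1 : ℝ) / (q.eval x.length + 1) ≤ F.kernelProb 0 x {y | f (y.take (p.eval x.length)) = h x}) :
    ∃ F : QCircuitFamily cliffordT, F.IsOracleFree ∧ F.IsUniform ∧ ∀ x, V x = true →
      2 / 3 ≤ F.kernelProb 0 x {y | f (y.take (p.eval x.length)) = h x} := by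
  sorry

/-- B3 (S). Glue B2 ⇒ B1-shape: the accepted-prefix event is the handle event. -/
theorem handle_event_eq (f h : List Bool → List Bool) (p : Polynomial ℕ) (x : List Bool) :
    {y : List Bool | f (y.take (p.eval x.length)) = h x ∧ p.eval x.length ≤ y.length} =
      {y | ∃ v, v.length = p.eval x.length ∧ f v = h x ∧ v <+: y} := by
  sorry

end Summit.QuantumAdvantage.QuantumAdvantage.Cruxes.PlLift.CertifiedCanonicalLift.StubIdeasK2

end
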